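import Summits.QuantumFields.YangMills.Theorems.BalabanUVNodesN19ContinuumJointLaws
import Mathlib.MeasureTheory.Constructions.Projective

/-!
# YM-DAG node N19 (= NE7 proper) — THE CONTINUUM JOINT LAWS, II: they form a PROJECTIVE family; `HasContinuumLimit` ⇔ convergence of all joint laws

Cell `pub-ymgap`, HUMAN RULING D-0062 (Track A), R141 (C) wider-strategy seat `pub-ymgap-dag-n19-e` (strategy s3 = ALTERNATIVE CURRENCY), generation
g18, module 7.  Route `Summits/QuantumFields/YangMills/Theses/BalabanUVNodes.lean` rev 25, cluster item K3⁷ «SpineGivenEndpointR13SepCoPH»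
(stmt-QuantumFields-20544, dag-lead WORDS-143); filed `--supports` that item `--as helper` (it proves no registered stub).  COUNT-NEUTRAL: bookkeeping over the
seat's p558060 `…N19ContinuumJointLaws` (`exists_jointContinuumLaw_of_hasContinuumLimit`, `jointLawLimit_unique`) BY NAME and Mathlib's
`MeasureTheory.IsProjectiveMeasureFamily` ∕ `IsProjectiveLimit.unique` (`Finset.restrict₂`); `Missing.HasContinuumLimit` is a HYPOTHESIS; no Theses import;
NOT a discharge claim.

THE RESULTS.  For a torus scheme `S` with `β_K ≥ 0` and measurable observables bounded by `1`:
* ★★ `isProjectiveMeasureFamily_of_jointLaws` — ANY assignment `J ↦ P_J` of probability laws on `ℝ^J` (`J : Finset (List O)`) receiving the limits of the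
  joint laws of `(∏os)_{os∈J}` is PROJECTIVE in Mathlib's sense (`IsProjectiveMeasureFamily (α := fun _ : List O => ℝ) P`: `P_J = (P_I).map (restrict₂)` for `J ⊆ I`) — marginals of
  limits are limits of marginals, by uniqueness of the weak limit (p558060 `jointLawLimit_unique`).
* ★★ `exists_projectiveFamily_of_hasContinuumLimit` — under `Missing.HasContinuumLimit S` (HYPOTHESIS) such an assignment exists (p558060 string-family by
  string-family), carried by the cubes `[−1,1]^J`: THE CONTINUUM FINITE-DIMENSIONAL DISTRIBUTIONS OF THE STRING FIELD FORM A CONSISTENT (PROJECTIVE) FAMILY.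
  Its projective limit on `ℝ^{List O}` — the continuum law of the whole string field on the fixed torus — is UNIQUE if it exists
  (★ `projectiveLimit_unique`, Mathlib `IsProjectiveLimit.unique`); its EXISTENCE is the Kolmogorov extension theorem, NOT in Mathlib at this snapshot and NOT
  claimed here.
* ★ `hasContinuumLimit_iff_jointLaws` — `HasContinuumLimit S` (convergence of every string expectation) is EQUIVALENT to weak convergence of the joint law of
  every finite family of string observables (→ p558060; ← the coordinate of a one-member family is a continuous observable).

HONEST FRAMING (binding).  Bookkeeping; NO consumer in the DAG today.  `HasContinuumLimit` is a HYPOTHESIS (the cell's located, unprinted estimates U1–U5 stand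
between Bałaban's papers and it); nothing of Bałaban's is instantiated; N19 NOT discharged; count-neutral.  One finite `T⁴` programme at fixed `ε` → 0 at FIXED
volume; nothing `ℝ⁴` ∕ infinite-volume ∕ OS ∕ mass-gap ∕ Clay.  0 `def` ∕ 0 `sorry`.
-/

noncomputable section

open Set Filter Topology MeasureTheory ProbabilityTheory

namespace Summit.QuantumFields.YangMills.Theorems.BalabanUVNodesN19ContinuumProjectiveFamily

open Literature.MathematicalPhysics.QuantumFieldTheory.Balaban1983to89
open T4GenFunBounds (prodObs gibbsMeasure expectAt_eq_integral_gibbs)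
open Missing (TorusScheme HasContinuumLimit)
open Summit.QuantumFields.YangMills.Theorems.BalabanUVNodesN19ContinuumJointLaws
  (exists_jointContinuumLaw_of_hasContinuumLimit jointLawLimit_unique)

section Scheme

variable {G : Type*} [GaugeGroup G] [MeasurableSpace G] [RegularGaugeGroup G] [HaarData G] {O : Type*}
  (S : TorusScheme G O) (hβ : ∀ K, 0 ≤ S.β K) (hm : ∀ K o, Measurable (S.obs K o))
  (h1 : ∀ K o U, |S.obs K o U| ≤ 1)

omit [RegularGaugeGroup G] in
/-- **FUNCTORIALITY OF THE CONTINUUM JOINT LAWS UNDER REINDEXING.**  For any map `φ : ι′ → ι` of finite index types (sub-families, permutations,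
repetitions): if `ν` receives the limits of the joint laws of `(∏os_i)_{i∈ι}` and `ν′` those of `(∏os_{φ j})_{j∈ι′}`, then `ν′ = ν.map (· ∘ φ)`
(the pushed-forward law also receives them; the weak limit is unique, p558060 `jointLawLimit_unique`). [folklore] -/
theorem jointLaw_reindex {ι ι' : Type*} [Fintype ι] [Fintype ι'] (φ : ι' → ι) (os : ι → List O)
    (ν : Measure (ι → ℝ)) (ν' : Measure (ι' → ℝ)) [IsProbabilityMeasure ν] [IsProbabilityMeasure ν']
    (hν : ∀ f : (ι → ℝ) → ℝ, Continuous f →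
      Tendsto (fun K => ∫ U, f (fun i => prodObs S K (os i) U) ∂gibbsMeasure (S.P K) (S.β K)) atTop (𝓝 (∫ x, f x ∂ν)))
    (hν' : ∀ f : (ι' → ℝ) → ℝ, Continuous f →
      Tendsto (fun K => ∫ U, f (fun j => prodObs S K (os (φ j)) U) ∂gibbsMeasure (S.P K) (S.β K)) atTop (𝓝 (∫ x, f x ∂ν'))) :
    ν' = ν.map (fun x : ι → ℝ => fun j => x (φ j)) := by
  have hr : Continuous (fun x : ι → ℝ => fun j => x (φ j)) := continuous_pi fun j => continuous_apply (φ j)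
  haveI : IsProbabilityMeasure (ν.map (fun x : ι → ℝ => fun j => x (φ j))) := Measure.isProbabilityMeasure_map hr.measurable.aemeasurable
  refine jointLawLimit_unique (μ := fun K => gibbsMeasure (S.P K) (S.β K)) (X := fun K (j : ι') U => prodObs S K (os (φ j)) U)
    ν' _ hν' fun f hf => ?_
  rw [integral_map hr.measurable.aemeasurable hf.aestronglyMeasurable]
  exact hν (fun x => f (fun j => x (φ j))) (hf.comp hr)

omit [RegularGaugeGroup G] in
/-- **★★ MARGINALS OF LIMITS ARE LIMITS OF MARGINALS: the continuum joint laws are PROJECTIVE.**  If, for every finite set `J` of strings, `P_J` is a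
probability law on `ℝ^J` receiving the limits `∫ f((∏os)_{os∈J}) dgibbs_K → ∫ f dP_J` of all continuous `f`, then `J ⊆ I ⇒ P_J = (P_I).map restrict₂`
(`MeasureTheory.IsProjectiveMeasureFamily (α := fun _ : List O => ℝ) P`): the pushed-forward law also receives those limits (`f ∘ restrict₂` is continuous and
`restrict₂ ((∏os)_{os∈I}) = (∏os)_{os∈J}`), and the weak limit is unique (p558060 `jointLawLimit_unique`). [folklore] -/
theorem isProjectiveMeasureFamily_of_jointLaws (P : ∀ J : Finset (List O), Measure (↥J → ℝ)) (hP1 : ∀ J, IsProbabilityMeasure (P J))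
    (hP : ∀ (J : Finset (List O)) (f : (↥J → ℝ) → ℝ), Continuous f →
      Tendsto (fun K => ∫ U, f (fun j : ↥J => prodObs S K j.1 U) ∂gibbsMeasure (S.P K) (S.β K)) atTop (𝓝 (∫ x, f x ∂P J))) :
    IsProjectiveMeasureFamily (α := fun _ : List O => ℝ) P := by
  intro I J hJI
  haveI := hP1 I
  haveI := hP1 J
  have hr : Continuous (Finset.restrict₂ (π := fun _ : List O => ℝ) hJI) := Finset.continuous_restrict₂ hJI
  haveI : IsProbabilityMeasure ((P I).map (Finset.restrict₂ (π := fun _ : List O => ℝ) hJI)) :=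
    Measure.isProbabilityMeasure_map hr.measurable.aemeasurable
  refine jointLawLimit_unique (μ := fun K => gibbsMeasure (S.P K) (S.β K)) (X := fun K (j : ↥J) U => prodObs S K j.1 U)
    (P J) ((P I).map (Finset.restrict₂ (π := fun _ : List O => ℝ) hJI)) (hP J) fun f hf => ?_
  rw [integral_map hr.measurable.aemeasurable hf.aestronglyMeasurable]
  exact hP I (fun x => f (Finset.restrict₂ (π := fun _ : List O => ℝ) hJI x)) (hf.comp hr)

include hβ hm h1

/-- **★★ UNDER `HasContinuumLimit`: THE CONTINUUM FINITE-DIMENSIONAL DISTRIBUTIONS OF THE STRING FIELD EXIST AND FORM A PROJECTIVE FAMILY.**  If all string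
expectations converge (`Missing.HasContinuumLimit S`, a HYPOTHESIS), there is an assignment `J ↦ P_J` (`J : Finset (List O)`) of probability laws on `ℝ^J`,
each carried by the cube `[−1,1]^J`, each the weak limit of the joint law of `(∏os)_{os∈J}` under `gibbs_K` (p558060), and the assignment is projective
(`MeasureTheory.IsProjectiveMeasureFamily (α := fun _ : List O => ℝ) P`).  This is exactly the hypothesis of the Kolmogorov extension theorem (whose conclusion — ONE law on `ℝ^{List O}`
with these marginals — is not in Mathlib at this snapshot and is NOT claimed). [folklore] -/
theorem exists_projectiveFamily_of_hasContinuumLimit (hC : HasContinuumLimit S) :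
    ∃ P : ∀ J : Finset (List O), Measure (↥J → ℝ),
      (∀ J, IsProbabilityMeasure (P J)) ∧
      (∀ J, P J (Set.pi Set.univ (fun _ : ↥J => Icc (-1) 1))ᶜ = 0) ∧
      (∀ (J : Finset (List O)) (f : (↥J → ℝ) → ℝ), Continuous f →
        Tendsto (fun K => ∫ U, f (fun j : ↥J => prodObs S K j.1 U) ∂gibbsMeasure (S.P K) (S.β K)) atTop (𝓝 (∫ x, f x ∂P J))) ∧
      IsProjectiveMeasureFamily (α := fun _ : List O => ℝ) P := by
  classical
  have h : ∀ J : Finset (List O), ∃ ν : Measure (↥J → ℝ), IsProbabilityMeasure ν ∧ ν (Set.pi Set.univ (fun _ : ↥J => Icc (-1) 1))ᶜ = 0 ∧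
      ∀ f : (↥J → ℝ) → ℝ, Continuous f →
        Tendsto (fun K => ∫ U, f (fun j : ↥J => prodObs S K j.1 U) ∂gibbsMeasure (S.P K) (S.β K)) atTop (𝓝 (∫ x, f x ∂ν)) := fun J => by
    obtain ⟨ν, iν, hν1, hν, -⟩ := exists_jointContinuumLaw_of_hasContinuumLimit S hβ hm h1 hC (ι := ↥J) (fun j => j.1)
    exact ⟨ν, iν, hν1, hν⟩
  choose P hP1 hPc hP using h
  exact ⟨P, hP1, hPc, hP, isProjectiveMeasureFamily_of_jointLaws S P hP1 hP⟩

omit hβ hm h1 in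
/-- **★ THE CONTINUUM LAW OF THE WHOLE STRING FIELD, IF IT EXISTS, IS UNIQUE** (Mathlib `IsProjectiveLimit.unique`): two laws on `ℝ^{List O}` that are both
projective limits of a family `P` of probability laws coincide.  Existence (Kolmogorov extension) is NOT claimed. [folklore] -/
theorem projectiveLimit_unique (P : ∀ J : Finset (List O), Measure (↥J → ℝ)) [∀ J, IsProbabilityMeasure (P J)]
    (Λ₁ Λ₂ : Measure (List O → ℝ)) (h₁ : IsProjectiveLimit (α := fun _ : List O => ℝ) Λ₁ P) (h₂ : IsProjectiveLimit (α := fun _ : List O => ℝ) Λ₂ P) : Λ₁ = Λ₂ :=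
  h₁.unique h₂

/-- **★ `HasContinuumLimit` ⇔ CONVERGENCE OF ALL FINITE-DIMENSIONAL JOINT LAWS.**  For a torus scheme with `β_K ≥ 0` and measurable observables bounded
by `1`: every string expectation converges IFF for every finite family of strings the joint law of the string observables converges weakly to some
probability law (→ p558060 `exists_jointContinuumLaw_of_hasContinuumLimit`; ← the coordinate of the one-member family `{os}` is a continuous observable
and `S.expectAt K os = ∫ ∏os dgibbs_K`). [folklore] -/
theorem hasContinuumLimit_iff_jointLaws :
    HasContinuumLimit S ↔
      ∀ (ι : Type) [Fintype ι] (os : ι → List O), ∃ ν : Measure (ι → ℝ), IsProbabilityMeasure ν ∧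
        ∀ f : (ι → ℝ) → ℝ, Continuous f →
          Tendsto (fun K => ∫ U, f (fun i => prodObs S K (os i) U) ∂gibbsMeasure (S.P K) (S.β K)) atTop (𝓝 (∫ x, f x ∂ν)) := by
  classical
  constructor
  · intro hC ι _ os
    obtain ⟨ν, iν, -, hν, -⟩ := exists_jointContinuumLaw_of_hasContinuumLimit S hβ hm h1 hC os
    exact ⟨ν, iν, hν⟩
  · intro h os
    obtain ⟨ν, iν, hν⟩ := h Unit (fun _ => os)
    refine ⟨∫ x, x () ∂ν, ?_⟩
    have h1' := hν (fun x => x ()) (continuous_apply ())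
    refine h1'.congr fun K => ?_
    rw [expectAt_eq_integral_gibbs S hβ K os]

end Scheme

end Summit.QuantumFields.YangMills.Theorems.BalabanUVNodesN19ContinuumProjectiveFamily

end
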